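import Summits.BirchSwinnertonDyer.Rank1Residual.X11b.RouteR1OpenInputTight
import Summits.BirchSwinnertonDyer.Rank1Residual.X11b.BDPRouteOpenInputTight
import Summits.BirchSwinnertonDyer.Rank1Residual.X11b.Three.ControlIdentityLocus
import Summits.BirchSwinnertonDyer.Rank1Residual.X11b.RouteLoci
import HarnessLib

/-!
# X11b at `p ≥ 5` — the TWO typed open inputs of the cell's two research routes AGREE on the overlap
# of their populations: `R1OpenInputOnTreeAt W p ↔ P2OpenInputOnTreeAt W p` on `R1Population ∩ Locus`

HONEST FRAMING (cell `b2b-bsdres`, run/shared/lean/b2b/bsd-rank1-residual/, verbatim in every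
file): the goal of the cell is to DELETE the COMBINATION-SHAPED residual classes of the
Birch–Swinnerton-Dyer formula for ALL analytic-rank `≤ 1` elliptic curves over `ℚ` — "full BSD
formula for every rank `≤ 1` curve in class `C`" assembled STRICTLY from published theorems — so
that the rank-`≤ 1` remainder becomes exactly the CONSTRUCTION-SHAPED classes, which are TYPED
(missing-input `Prop`s), NOT attempted. This is not "finishing BSD". Sub-cell
`b2b-bsdres-multr1-p1` (X11b, route R1), gen 19; a RESEARCH ROUTE; no claim beyond the stated
class; X11b stays CONSTRUCTION-SHAPED; nothing here changes a label; nothing is booked; no named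
fact is minted (THEOREMS ONLY; no definition; no `sorry`). CONDITIONAL: every published / cited
named fact is a hypothesis; neither open input is proved.

## What this file proves (gen 19)

The cell types X11b at `p ≥ 5` (`r_an = 1`, `p ∥ N`, `E[p]` irreducible) through TWO research
routes with two DIFFERENT-looking open inputs on the constructed anticyclotomic Selmer dual
`X_ac(E[p^∞])`:

* route R1 (sub-cell multr1-p1; Castella 2018 Thm. A along the erratum): `R1OpenInputOnTreeAt W p` —
  the EQUALITY (IMC)∘(BDP) at `𝟙`, "`ord_p f_ac(0) = 2·(ord_p log_{ω_E} P_K − 1)`", at the Manin-good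
  Heegner data of ERRATUM fields (one ramified prime `q`) of the pair, on `R1Population`
  (`ChainLocus` ∧ an odd non-split ramified `q`);
* route p2 (sub-cell multr1-p2; BDP + converse-theorem engine + Kolyvagin): `P2OpenInputOnTreeAt W p`
  — the INEQUALITY (IMC≥)∘(BDP) at `𝟙`, "`2·(ord_p log_ω P − 1) ≤ ord_p f_ac(0)`", at the odd-`d_K`
  Manin-good Heegner data of CLASSICAL Heegner fields (every `ℓ ∣ N` split) of the pair, on the Locus
  (`5 ≤ p ∧ Ram ∧ p ∤ ∏ c_ℓ`).

Both are TIGHT given the published + cited facts: `R1.openInputOnTreeAt_iff_bsdp_final` (this gen,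
`RouteR1OpenInputTight`) and multr1-p2's `P2.openInputOnTreeAt_iff_bsdp_of_locus`
(`BDPRouteOpenInputTight`, gen 18 of p2) — the latter modulo the PUB-shaped control identity
`P2ControlOnTreeAt W p`, which is a tree theorem on the Locus modulo Kolyvagin's finiteness and four
cited cohomological facts since x11b3-p9's `p2ControlOnTreeAt_of_locus` (`Three/ControlIdentityLocus`).
Hence:

* **`openInputs_agree_of_r1Population_of_locus`** — for every globally minimal elliptic `W/ℚ` and
  prime `p` on `R1Population W p` with `p ∤ ∏_ℓ c_ℓ(E)` (so on the Locus) and `ord_{s=1} L(E,s) = 1`,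
  given the union of the two routes' PUBLISHED named facts (Gross–Zagier 1986 I.7.3 and the
  Gross–Zagier / Kolyvagin facts over `K`, Kolyvagin's 1990 index bound, Skinner 2016 Thm. C,
  Wuthrich 2014 Prop. 21, GZK, modularity, Cai–Shu–Tian 2014 Thm. 1.1, Hoffstein–Luo 1997,
  Friedberg–Hoffstein (ramified form), Mazur 1978 Cor. 4.1) and CITED facts (Poitou–Tate for Selmer
  structures; Poitou–Tate for `Ш`; the Poitou–Tate sum formula; local Euler–Poincaré; `cd_p ≤ 2`;
  Brink 2007): **`R1OpenInputOnTreeAt W p ↔ P2OpenInputOnTreeAt W p`** (both `↔ BSDp W p`).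
  So on the overlap the cell carries ONE open input in two printings, and a refereed proof of EITHER
  shape (FW21 Thm. 4.41's equality at `𝟙` on erratum-field data, or the one-sided divisibility (2.4)
  at classical Heegner data) settles BOTH routes there. `bsdp_iff_openInputs_of_r1Population_of_locus`
  records the three-way equivalence.

What this is NOT: no open input is proved; nothing is booked; the facts are hypotheses; off the
overlap (R1 pairs with `p ∣ ∏c`; Locus pairs without an odd non-split ramified `q` or a second
ramified prime) only the respective route's own tightness statement applies. CONDITIONAL.

References: [Castella2018] Thm. 2.3, Thm. 3.2, §5 (arXiv:1704.06608 pp. 5, 9, 12);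
[Castella2018Erratum] Thm. 1.1, (2.4) (p. 1); [JetchevSkinnerWan2017] Thm. 3.3.1, §7.4;
[Skinner2016PacificMC] Thm. C; [Kolyvagin1990] (index bound); [Wuthrich2014] Prop. 21;
[CaiShuTian2014] Thm. 1.1; [HoffsteinLuo1997]; [FriedbergHoffstein1995] Thm. B; [Mazur1978] Cor. 4.1;
[Brink2007] Thm. 2 / Cor. 1; [Miller2011LMS] Def. 1.1. Cell record: HOME/b2b-bsdres-multr1-p1/REPORT.md §29.
-/

set_option autoImplicit false

noncomputable section

open scoped Classical

open WeierstrassCurve NumberField IsDedekindDomain Field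
open Literature.NumberTheory.EllipticCurves Literature.NumberTheory.EllipticCurves.GreenbergSelmer
open Literature.NumberTheory.EllipticCurves.ModularForms
open Literature.NumberTheory.EllipticCurves.Rank1Residual
open Literature.NumberTheory.EllipticCurves.Rank1Residual.Typed
open Literature.NumberTheory.EllipticCurves.Wuthrich2014
open Literature.NumberTheory.EllipticCurves.Castella2018
open Literature.NumberTheory.GaloisRepresentations
open Literature.NumberTheory.GaloisCohomology
open Summit.BirchSwinnertonDyer.Rank1Residual.X11b.AcSelmer

namespace Summit.BirchSwinnertonDyer.Rank1Residual.X11b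

section Agree

variable (W : WeierstrassCurve ℚ) [W.IsElliptic] [W.IsGloballyMinimal] (p : ℕ) [Fact p.Prime]

/-- **`BSD(E,p)` ⟺ route p2's open input, on `R1Population ∩ Locus`, with NO PUB-shaped hypothesis**:
multr1-p2's `P2.openInputOnTreeAt_iff_bsdp_of_locus` with its control-identity binder supplied by
x11b3-p9's `p2ControlOnTreeAt_of_locus` (Kolyvagin finiteness + four cited cohomological facts); the
pair data `ClassX11b`, `5 ≤ p`, `Ram` come from `R1Population` (`R1Population.classX11b`,
`ChainLocus.ram`). [cite: JetchevSkinnerWan2017, Thm. 3.3.1 and §7.4 (arXiv:1512.06894 pp. 11, 30–31)]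
[cite: Castella2018, Thm. 2.3 (p. 5), Thm. 3.2 (p. 9)] [cite: Castella2018Erratum, (2.4) (p. 1)]
[cite: Miller2011LMS, Def. 1.1] -/
theorem P2.openInputOnTreeAt_iff_bsdp_of_r1Population_of_locus
    (hGZ : ∀ (N : ℕ) [NeZero N] (W : WeierstrassCurve ℚ) (K : Type) [Field K] [NumberField K],
      gross_zagier N W K)
    (hKo : ∀ (N : ℕ) [NeZero N] (W : WeierstrassCurve ℚ) (K : Type) [Field K] [NumberField K],
      kolyvagin N W K)
    (hB : ∀ (N : ℕ) [NeZero N] (W : WeierstrassCurve ℚ) (K : Type) [Field K] [NumberField K],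
      Kolyvagin1990_padicValNat_card_sha_le N W K)
    (hSk : Skinner2016.thmC_padicValRat_bsd_rank_zero) (hWu : sha_dvd_analyticSha)
    (hGZK : rank_eq_analyticRank_of_analyticRank_le_one) (hnf : exists_isNewformOf)
    (hHL : HoffsteinLuo1997_exists_twist_L_one_ne_zero)
    (hMaz : mazur_not_dvd_maninConstant_of_odd)
    (hPTs : ∀ (K : Type) [Field K] [NumberField K], poitouTate_sum_localTatePairing_eq_zero K)
    (hPT : ∀ (K : Type) [Field K] [NumberField K], poitouTate_selmerStructure_duality K)
    (hPT2 : ∀ (K : Type) [Field K] [NumberField K], poitouTate_sha_tateDual K)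
    (hEP : ∀ (K : Type) [Field K] [NumberField K] (v : HeightOneSpectrum (𝓞 K)),
      localEulerPoincareCharacteristic (v.adicCompletion K))
    (hcd : fieldCdLE_two_of_numberField)
    (hW : R1Population W p) (htam : ¬ p ∣ W.tamagawaProduct) (hr : W.analyticRank = 1) :
    P2OpenInputOnTreeAt W p ↔ BSDp W p :=
  have hX : ClassX11b W p := hW.classX11b hr
  P2.openInputOnTreeAt_iff_bsdp_of_locus W p hGZ hKo hB hSk hWu hGZK
    (hasEntireLFunction_rat_of_exists_isNewformOf hnf) hnf hHL hMaz hPTs hEP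
    (p2ControlOnTreeAt_of_locus W p hKo hPT hPT2 hEP hcd hX hW.1.ram htam) hX hW.1.1 hW.1.ram htam

/-- **THE TWO ROUTES' OPEN INPUTS AGREE on `R1Population ∩ Locus`.** For every globally minimal
elliptic `W/ℚ` and prime `p` on `R1Population W p` (`5 ≤ p`, `mult(p)`, `irr(p)`, the A′-hypotheses, a
second ramified multiplicative prime, an odd non-split ramified `q`) with `p ∤ ∏_ℓ c_ℓ(E)` and
`ord_{s=1} L(E,s) = 1`, given the union of the two routes' PUBLISHED named facts (`hGZ1` Gross–Zagier
1986 I.7.3; `hGZ`, `hKo` Gross–Zagier / Kolyvagin over `K`; `hB` Kolyvagin 1990; `hSk` Skinner 2016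
Thm. C; `hWu` Wuthrich 2014 Prop. 21; `hGZK`; `hnf` modularity; `hCST` Cai–Shu–Tian 2014 Thm. 1.1;
`hHL` Hoffstein–Luo 1997; `hFH` Friedberg–Hoffstein, ramified form; `hMaz` Mazur 1978 Cor. 4.1) and
CITED facts (`hPTs` Poitou–Tate sum formula; `hPT` Poitou–Tate for Selmer structures; `hPT2`
Poitou–Tate for `Ш`; `hEP` local Euler–Poincaré; `hcd` `cd_p ≤ 2`; `hBr` Brink 2007):
**`R1OpenInputOnTreeAt W p ↔ P2OpenInputOnTreeAt W p`** — route R1's EQUALITY-shaped (IMC)∘(BDP) at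
`𝟙` on erratum-field data and route p2's INEQUALITY-shaped (IMC≥)∘(BDP) at `𝟙` on classical
Heegner-field data are equivalent, both being equivalent to `BSD(E,p)`
(`R1.openInputOnTreeAt_iff_bsdp_final`, `P2.openInputOnTreeAt_iff_bsdp_of_r1Population_of_locus`).
A refereed proof of either printing settles both routes on the overlap. CONDITIONAL (facts as
hypotheses); neither input is proved; nothing booked; no label change.
[cite: Castella2018, Thm. 2.3, Thm. 3.2, §5 (arXiv:1704.06608 pp. 5, 9, 12)]
[cite: Castella2018Erratum, Thm. 1.1 and (2.4) (p. 1)] [cite: JetchevSkinnerWan2017, Thm. 3.3.1, §7.4]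
[cite: Miller2011LMS, Def. 1.1] -/
theorem openInputs_agree_of_r1Population_of_locus
    (hGZ1 : GrossZagier1986_thm_I_7_3)
    (hGZ : ∀ (N : ℕ) [NeZero N] (W : WeierstrassCurve ℚ) (K : Type) [Field K] [NumberField K],
      gross_zagier N W K)
    (hKo : ∀ (N : ℕ) [NeZero N] (W : WeierstrassCurve ℚ) (K : Type) [Field K] [NumberField K],
      kolyvagin N W K)
    (hB : ∀ (N : ℕ) [NeZero N] (W : WeierstrassCurve ℚ) (K : Type) [Field K] [NumberField K],
      Kolyvagin1990_padicValNat_card_sha_le N W K)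
    (hSk : Skinner2016.thmC_padicValRat_bsd_rank_zero) (hWu : sha_dvd_analyticSha)
    (hGZK : rank_eq_analyticRank_of_analyticRank_le_one) (hnf : exists_isNewformOf)
    (hCST : CaiShuTian2014.thm11_trivialChar) (hHL : HoffsteinLuo1997_exists_twist_L_one_ne_zero)
    (hFH : friedbergHoffstein_exists_twist_ne_zero_ramifiedAt)
    (hMaz : mazur_not_dvd_maninConstant_of_odd)
    (hPTs : ∀ (K : Type) [Field K] [NumberField K], poitouTate_sum_localTatePairing_eq_zero K)
    (hPT : ∀ (K : Type) [Field K] [NumberField K], poitouTate_selmerStructure_duality K)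
    (hPT2 : ∀ (K : Type) [Field K] [NumberField K], poitouTate_sha_tateDual K)
    (hEP : ∀ (K : Type) [Field K] [NumberField K] (v : HeightOneSpectrum (𝓞 K)),
      localEulerPoincareCharacteristic (v.adicCompletion K))
    (hcd : fieldCdLE_two_of_numberField)
    (hBr : ∀ (K : Type) [Field K] [NumberField K] (p : ℕ) [Fact p.Prime],
      ZpExtension.decomp_not_le_kerSubgroup_of_isAnticyclotomic K p)
    (hW : R1Population W p) (htam : ¬ p ∣ W.tamagawaProduct) (hr : W.analyticRank = 1) :
    R1OpenInputOnTreeAt W p ↔ P2OpenInputOnTreeAt W p :=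
  (R1.openInputOnTreeAt_iff_bsdp_final W p hGZ1 hGZK hSk hnf hCST hFH hMaz hPT hPT2 hEP hcd hBr hW
      hr).trans
    (P2.openInputOnTreeAt_iff_bsdp_of_r1Population_of_locus W p hGZ hKo hB hSk hWu hGZK hnf hHL hMaz
      hPTs hPT hPT2 hEP hcd hW htam hr).symm

/-- **Three-way record on the overlap**: `BSD(E,p)`, route R1's open input and route p2's open input
are pairwise equivalent on `R1Population ∩ Locus ∩ {r_an = 1}` given the facts of
`openInputs_agree_of_r1Population_of_locus`. [cite: Castella2018Erratum, Thm. 1.1 and (2.4) (p. 1)]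
[cite: Miller2011LMS, Def. 1.1] -/
theorem bsdp_iff_openInputs_of_r1Population_of_locus
    (hGZ1 : GrossZagier1986_thm_I_7_3)
    (hGZ : ∀ (N : ℕ) [NeZero N] (W : WeierstrassCurve ℚ) (K : Type) [Field K] [NumberField K],
      gross_zagier N W K)
    (hKo : ∀ (N : ℕ) [NeZero N] (W : WeierstrassCurve ℚ) (K : Type) [Field K] [NumberField K],
      kolyvagin N W K)
    (hB : ∀ (N : ℕ) [NeZero N] (W : WeierstrassCurve ℚ) (K : Type) [Field K] [NumberField K],
      Kolyvagin1990_padicValNat_card_sha_le N W K)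
    (hSk : Skinner2016.thmC_padicValRat_bsd_rank_zero) (hWu : sha_dvd_analyticSha)
    (hGZK : rank_eq_analyticRank_of_analyticRank_le_one) (hnf : exists_isNewformOf)
    (hCST : CaiShuTian2014.thm11_trivialChar) (hHL : HoffsteinLuo1997_exists_twist_L_one_ne_zero)
    (hFH : friedbergHoffstein_exists_twist_ne_zero_ramifiedAt)
    (hMaz : mazur_not_dvd_maninConstant_of_odd)
    (hPTs : ∀ (K : Type) [Field K] [NumberField K], poitouTate_sum_localTatePairing_eq_zero K)
    (hPT : ∀ (K : Type) [Field K] [NumberField K], poitouTate_selmerStructure_duality K)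
    (hPT2 : ∀ (K : Type) [Field K] [NumberField K], poitouTate_sha_tateDual K)
    (hEP : ∀ (K : Type) [Field K] [NumberField K] (v : HeightOneSpectrum (𝓞 K)),
      localEulerPoincareCharacteristic (v.adicCompletion K))
    (hcd : fieldCdLE_two_of_numberField)
    (hBr : ∀ (K : Type) [Field K] [NumberField K] (p : ℕ) [Fact p.Prime],
      ZpExtension.decomp_not_le_kerSubgroup_of_isAnticyclotomic K p)
    (hW : R1Population W p) (htam : ¬ p ∣ W.tamagawaProduct) (hr : W.analyticRank = 1) :
    (BSDp W p ↔ R1OpenInputOnTreeAt W p) ∧ (BSDp W p ↔ P2OpenInputOnTreeAt W p) :=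
  ⟨(R1.openInputOnTreeAt_iff_bsdp_final W p hGZ1 hGZK hSk hnf hCST hFH hMaz hPT hPT2 hEP hcd hBr hW
      hr).symm,
    (P2.openInputOnTreeAt_iff_bsdp_of_r1Population_of_locus W p hGZ hKo hB hSk hWu hGZK hnf hHL hMaz
      hPTs hPT hPT2 hEP hcd hW htam hr).symm⟩

/-- **Route p2's open input is TIGHT on the WHOLE Locus with NO PUB-shaped hypothesis** (gen 19
addendum; the form suggested to multr1-p2): multr1-p2's `P2.openInputOnTreeAt_iff_bsdp_of_locus`
with its control-identity binder `P2ControlOnTreeAt W p` DISCHARGED by x11b3-p9's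
`p2ControlOnTreeAt_of_locus` (Kolyvagin's finiteness `hKo` + the four cited cohomological facts
`hPT`, `hPT2`, `hEP`, `hcd`). For `W/ℚ` globally minimal elliptic and `p` with `ClassX11b W p`,
`5 ≤ p`, a (ram) prime and `p ∤ ∏_ℓ c_ℓ(E)`: `P2OpenInputOnTreeAt W p ↔ BSDp W p`, from published
and cited facts only. CONDITIONAL (facts as hypotheses); nothing booked; no label change.
[cite: JetchevSkinnerWan2017, Thm. 3.3.1 and §7.4 (arXiv:1512.06894 pp. 11, 30–31)]
[cite: Castella2018, Thm. 2.3 (p. 5), Thm. 3.2 (p. 9)] [cite: Castella2018Erratum, (2.4) (p. 1)]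
[cite: Miller2011LMS, Def. 1.1] -/
theorem P2.openInputOnTreeAt_iff_bsdp_of_locus_citedControl
    (hGZ : ∀ (N : ℕ) [NeZero N] (W : WeierstrassCurve ℚ) (K : Type) [Field K] [NumberField K],
      gross_zagier N W K)
    (hKo : ∀ (N : ℕ) [NeZero N] (W : WeierstrassCurve ℚ) (K : Type) [Field K] [NumberField K],
      kolyvagin N W K)
    (hB : ∀ (N : ℕ) [NeZero N] (W : WeierstrassCurve ℚ) (K : Type) [Field K] [NumberField K],
      Kolyvagin1990_padicValNat_card_sha_le N W K)
    (hSk : Skinner2016.thmC_padicValRat_bsd_rank_zero) (hWu : sha_dvd_analyticSha)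
    (hGZK : rank_eq_analyticRank_of_analyticRank_le_one) (hnf : exists_isNewformOf)
    (hHL : HoffsteinLuo1997_exists_twist_L_one_ne_zero)
    (hMaz : mazur_not_dvd_maninConstant_of_odd)
    (hPTs : ∀ (K : Type) [Field K] [NumberField K], poitouTate_sum_localTatePairing_eq_zero K)
    (hPT : ∀ (K : Type) [Field K] [NumberField K], poitouTate_selmerStructure_duality K)
    (hPT2 : ∀ (K : Type) [Field K] [NumberField K], poitouTate_sha_tateDual K)
    (hEP : ∀ (K : Type) [Field K] [NumberField K] (v : HeightOneSpectrum (𝓞 K)),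
      localEulerPoincareCharacteristic (v.adicCompletion K))
    (hcd : fieldCdLE_two_of_numberField)
    (hX : ClassX11b W p) (hp5 : 5 ≤ p) (hram : Ram W p) (htam : ¬ p ∣ W.tamagawaProduct) :
    P2OpenInputOnTreeAt W p ↔ BSDp W p :=
  P2.openInputOnTreeAt_iff_bsdp_of_locus W p hGZ hKo hB hSk hWu hGZK
    (hasEntireLFunction_rat_of_exists_isNewformOf hnf) hnf hHL hMaz hPTs hEP
    (p2ControlOnTreeAt_of_locus W p hKo hPT hPT2 hEP hcd hX hram htam) hX hp5 hram htam

end Agree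

end Summit.BirchSwinnertonDyer.Rank1Residual.X11b

end
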